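import Mathlib
import HarnessLib

/-!
# QUANT lane R8, Conjecture DIB\* — the TRUNCATED-MEAN THEOREM for light clouds, part I: the four real inequalities of the induction
# (peel / top / two lights / three lights)

builds on p205010 (kernel theorem, internal audit signed; external expert review pending)

Support file (`--supports stmt-CriticalPhenomena-4575`), QUANT lane census seat prim-quant-census-1 (gen 16), rung R8 of
`run/shared/lean/prim/quant/LADDER.md`; memo `run/shared/lean/prim/quant/prim-quant-census-1/TRUNCATED-MEAN-G16.md`.  Part (VII) of the cloud
series (`…CloudComponents` I, `…SmallCloud` II, `…BigLights` III, `…CloudClamp` IV, `…TwoMediumLights` V, `…TwoBins` VI).  Theorems only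
(statements about real numbers), no definitions, no sorries, standard axioms.

THE TRUNCATED-MEAN THEOREM (part VIII `…TruncatedMean`, proved there by induction on the cloud).  A LIGHT CLOUD: blobs `l` with sizes
`b_l ≥ 0` and gates `g_l ∈ [x², x)`, floor `1/2 ≤ x < 1`, discounted credit `C = Σ_l b_l κ_x(g_l)`, `κ_x(g) = (g − x²)/(1 − x)`, open mass
`Λ = Σ_{l open} b_l`.  **For every real `t ≥ max_l b_l`: `E[min(Λ, t)] ≥ min(C, x·t)`, and `> x·t` when `C > x·t`.**  (SMALL-CLOUD-G15 §10–§12: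
the conjectured inequalities (TM), (OS) `E[(Λ − C/x)₊] ≤ x²(Σ b − C/x)` and (LE), 1 500 968 exact instances / 0; proved here for any number of
lights.)  With the clamp certificate (`IndepBlob.tail_ge_of_clampCert`, part IV) it gives Conjecture DIB\* for every corner instance whose lights
are all MEDIUM (`x·a ≤ 2j − C_H < 2a`) — part IX `…AllMedium`, CONJECTURE (ALL-MEDIUM) of SMALL-CLOUD-G15 §11.

THE INDUCTION (memo §2).  `T_L(t) := E[min(Λ_L, t)]`; claim `T_L(t) ≥ min(C_L, xt)` for `t ≥ max b`.  Let `b₁` be the smallest and `b` the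
largest size.  (P) If `b₁ + b ≤ t`, condition on the smallest light: `T_L(t) = g₁(b₁ + T_{L'}(t − b₁)) + (1 − g₁)T_{L'}(t)` and both
targets are admissible for `L' = L − ℓ₁` — `tm_peel` closes with `(g₁ − x)² ≥ 0`.  (NP) If `b₁ + b > t`, condition on the LARGEST light: when it
is open every other open light completes the target, so that branch is EXACTLY `t − (t − b)·Q'`, `Q' = Π_{L'}(1 − g)`; the closed branch is
`T_{L'}(t) ≥ min(C', xt)` by induction — `tm_top` closes with the same square whenever `Q' ≤ 1 − x`, which is automatic for `|L'| ≥ 3`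
(`(1 − x²)³ ≤ 1 − x`, `one_sub_sq_pow_three_le`); the two residual shapes `|L'| = 1, 2` are the explicit two- and three-light inequalities
`tm_two` (slack `(Σb − t)(x² − g₁g₂)`, the identity of `…TwoMediumLights`) and `tm_three` (slack
`θ(x² − g₃(1 − q₁q₂)) + g₃(g₁q₂b₂ + g₂q₁b₁) − g₁g₂q₃(b₁ + b₂ − t)₊ ≥ b₁(x² − g₁g₂)`, using `q₁q₂ ≥ 1 − x`).  In all four the discounted
credits enter through `K_l (1 − x) = b_l (g_l − x²)`.

* `Quant.IndepBlob.tm_peel`, `Quant.IndepBlob.tm_top`, `Quant.IndepBlob.tm_two`, `Quant.IndepBlob.tm_three` — the four steps;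
* `Quant.IndepBlob.one_sub_sq_pow_three_le` — `(1 − x²)³ ≤ 1 − x` on `[1/2, 1]`.

NOVELTY.  presearch 2026-08-21: "lower bound for the truncated mean E[min(S,t)] of a weighted Bernoulli sum by conditioning on the largest
summand" / "anti-concentration weighted Bernoulli truncated first moment" → none (corpus hybrid + vsearch: Hoeffding 1956 and Paley–Zygmund
textbook pages; galaxy `truncated mean|E[min(S`: unrelated); nearest in-tree: `…TwoMediumLights` (the two-light case).  [this work; this lane's
census]; the gluing rows served: [cite: KozmaNitzan2024, Conjecture 3 (p. 15)]; product weights [cite: Grimmett1999, §1.3 p. 10].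
-/

namespace Summit.CriticalPhenomena.PercolationContinuityZ3.Theorems

namespace Quant

namespace IndepBlob

/-! ### 15. The four real inequalities of the truncated-mean induction -/

/-- The square behind every step: `g(1 − x)² − (1 − g)(g − x²) = (g − x)²`, in the form
`(1 − g)·K ≤ g·b·(1 − x)` for the discounted credit `K (1 − x) = b (g − x²)`. [this work] -/
theorem discount_le_of_sq (x g b K : ℝ) (hx1 : x < 1) (hb : 0 ≤ b) (hK : K * (1 - x) = b * (g - x ^ 2)) :
    (1 - g) * K ≤ g * b * (1 - x) := by
  have h1x : 0 < 1 - x := by linarith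
  -- multiply by `1 − x > 0`
  have key : ((1 - g) * K) * (1 - x) ≤ (g * b * (1 - x)) * (1 - x) := by
    have e : ((1 - g) * K) * (1 - x) = (1 - g) * (b * (g - x ^ 2)) := by rw [mul_assoc, hK]
    rw [e]
    nlinarith [mul_nonneg hb (sq_nonneg (g - x))]
  exact le_of_mul_le_mul_right key h1x

/-- The discounted credit is at most the mean: `K ≤ g·b` (`g ≤ x`, `b ≥ 0`, `K(1 − x) = b(g − x²)`). [this work] -/
theorem discount_le_mean (x g b K : ℝ) (hx0 : 0 ≤ x) (hx1 : x < 1) (hgx : g ≤ x) (hb : 0 ≤ b)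
    (hK : K * (1 - x) = b * (g - x ^ 2)) : K ≤ g * b := by
  have h1x : 0 < 1 - x := by linarith
  have key : K * (1 - x) ≤ (g * b) * (1 - x) := by
    rw [hK]
    nlinarith [mul_nonneg hb (mul_nonneg hx0 (sub_nonneg.2 hgx))]
  exact le_of_mul_le_mul_right key h1x

/-- **Step (P) — peel the smallest light.**  `T = g(b + T₁) + (1 − g)T₀` with `T₁ ≥ min(C', x(t − b))`, `T₀ ≥ min(C', xt)` (and the
strict versions) ⟹ `T ≥ min(C' + K, xt)`, strictly above `xt` when `C' + K > xt`. [this work] -/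
theorem tm_peel (x g b K C' t T₁ T₀ : ℝ) (hx0 : 0 < x) (hx1 : x < 1) (hg0 : 0 ≤ g) (hgx : g ≤ x) (hb : 0 ≤ b)
    (hK : K * (1 - x) = b * (g - x ^ 2))
    (h₁ : min C' (x * (t - b)) ≤ T₁) (h₁s : x * (t - b) < C' → x * (t - b) < T₁)
    (h₀ : min C' (x * t) ≤ T₀) (h₀s : x * t < C' → x * t < T₀) :
    min (C' + K) (x * t) ≤ g * (b + T₁) + (1 - g) * T₀ ∧
      (x * t < C' + K → x * t < g * (b + T₁) + (1 - g) * T₀) := by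
  have hg1 : 0 < 1 - g := by linarith
  have hKgb : K ≤ g * b := discount_le_mean x g b K hx0.le hx1 hgx hb hK
  have hsq : (1 - g) * K ≤ g * b * (1 - x) := discount_le_of_sq x g b K hx1 hb hK
  have hxb : x * (t - b) ≤ x * t := by nlinarith
  rcases le_or_gt C' (x * (t - b)) with hA | hA
  · -- (A) both branches at least `C'`
    have hT₁ : C' ≤ T₁ := by rw [min_eq_left hA] at h₁; exact h₁
    have hT₀ : C' ≤ T₀ := by rw [min_eq_left (hA.trans hxb)] at h₀; exact h₀
    have e₁ : g * C' ≤ g * T₁ := mul_le_mul_of_nonneg_left hT₁ hg0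
    have e₀ : (1 - g) * C' ≤ (1 - g) * T₀ := mul_le_mul_of_nonneg_left hT₀ hg1.le
    have hT : C' + K ≤ g * (b + T₁) + (1 - g) * T₀ := by nlinarith
    exact ⟨(min_le_left _ _).trans hT, fun h => h.trans_le hT⟩
  rcases le_or_gt C' (x * t) with hB | hC
  · -- (B) `x(t − b) < C' ≤ xt`
    have hT₁ : x * (t - b) < T₁ := h₁s hA
    have hT₀ : C' ≤ T₀ := by rw [min_eq_left hB] at h₀; exact h₀
    have e₁ : g * (x * (t - b)) ≤ g * T₁ := mul_le_mul_of_nonneg_left hT₁.le hg0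
    have e₀ : (1 - g) * C' ≤ (1 - g) * T₀ := mul_le_mul_of_nonneg_left hT₀ hg1.le
    have hT : g * (b + x * (t - b)) + (1 - g) * C' ≤ g * (b + T₁) + (1 - g) * T₀ := by nlinarith
    rcases le_or_gt (C' + K) (x * t) with hC1 | hC2
    · refine ⟨?_, fun h => absurd h (not_lt.2 hC1)⟩
      rw [min_eq_left hC1]
      have e₂ : g * K ≤ g * (x * t - C') := mul_le_mul_of_nonneg_left (by linarith) hg0
      nlinarith
    · have e₂ : (1 - g) * (x * t - C') < (1 - g) * K := mul_lt_mul_of_pos_left (by linarith) hg1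
      have hlt : x * t < g * (b + x * (t - b)) + (1 - g) * C' := by nlinarith
      exact ⟨(min_le_right _ _).trans (hlt.trans_le hT).le, fun _ => hlt.trans_le hT⟩
  · -- (C) `C' > xt`: both branches strictly above their floors
    have hT₁ : x * (t - b) < T₁ := h₁s (lt_of_le_of_lt hxb hC)
    have hT₀ : x * t < T₀ := h₀s hC
    have e₁ : g * (x * (t - b)) ≤ g * T₁ := mul_le_mul_of_nonneg_left hT₁.le hg0
    have e₀ : (1 - g) * (x * t) < (1 - g) * T₀ := mul_lt_mul_of_pos_left hT₀ hg1
    have e₂ : 0 ≤ g * b * (1 - x) := mul_nonneg (mul_nonneg hg0 hb) (by linarith)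
    have hlt : x * t < g * (b + T₁) + (1 - g) * T₀ := by nlinarith
    exact ⟨(min_le_right _ _).trans hlt.le, fun _ => hlt⟩

/-- **Step (NP) — condition on the largest light, inductive closed branch.**  `T = g(t − (t − b)Q) + (1 − g)T₀` with `b > 0`,
`(t − b)Q ≤ (t − b)(1 − x)` (i.e. `t = b` or `Q ≤ 1 − x`), `T₀ ≥ min(C', xt)` ⟹ `T ≥ min(C' + K, xt)`, strictly above `xt` when `C' + K > xt`. [this work] -/
theorem tm_top (x g b K C' t Q T₀ : ℝ) (hx1 : x < 1) (hg0 : 0 < g) (hgx : g ≤ x) (hb : 0 < b)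
    (hQ : (t - b) * Q ≤ (t - b) * (1 - x)) (hK : K * (1 - x) = b * (g - x ^ 2)) (h₀ : min C' (x * t) ≤ T₀) :
    min (C' + K) (x * t) ≤ g * (t - (t - b) * Q) + (1 - g) * T₀ ∧
      (x * t < C' + K → x * t < g * (t - (t - b) * Q) + (1 - g) * T₀) := by
  have hg1 : 0 < 1 - g := by linarith
  have hsq : (1 - g) * K ≤ g * b * (1 - x) := discount_le_of_sq x g b K hx1 hb.le hK
  have hgb : 0 < g * b * (1 - x) := mul_pos (mul_pos hg0 hb) (by linarith)
  -- the open branch exceeds `x t` by at least `g b (1 − x)`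
  have hopen : g * (x * t) + g * b * (1 - x) ≤ g * (t - (t - b) * Q) := by
    have : g * ((t - b) * Q) ≤ g * ((t - b) * (1 - x)) := mul_le_mul_of_nonneg_left hQ hg0.le
    nlinarith
  rcases le_or_gt (x * t) C' with hA | hA
  · -- closed branch at least `x t`
    have hT₀ : x * t ≤ T₀ := by rw [min_eq_right hA] at h₀; exact h₀
    have e₀ : (1 - g) * (x * t) ≤ (1 - g) * T₀ := mul_le_mul_of_nonneg_left hT₀ hg1.le
    have hlt : x * t < g * (t - (t - b) * Q) + (1 - g) * T₀ := by nlinarith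
    exact ⟨(min_le_right _ _).trans hlt.le, fun _ => hlt⟩
  · have hT₀ : C' ≤ T₀ := by rw [min_eq_left hA.le] at h₀; exact h₀
    have e₀ : (1 - g) * C' ≤ (1 - g) * T₀ := mul_le_mul_of_nonneg_left hT₀ hg1.le
    have hT : g * (t - (t - b) * Q) + (1 - g) * C' ≤ g * (t - (t - b) * Q) + (1 - g) * T₀ := by linarith
    rcases le_or_gt (C' + K) (x * t) with hC1 | hC2
    · refine ⟨?_, fun h => absurd h (not_lt.2 hC1)⟩
      rw [min_eq_left hC1]
      -- `g t − g (t − b) Q − g C' − K ≥ g b (1 − x) − (1 − g) K ≥ 0`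
      have e₂ : g * K ≤ g * (x * t - C') := mul_le_mul_of_nonneg_left (by linarith) hg0.le
      nlinarith
    · have e₂ : (1 - g) * (x * t - C') < (1 - g) * K := mul_lt_mul_of_pos_left (by linarith) hg1
      have hlt : x * t < g * (t - (t - b) * Q) + (1 - g) * C' := by nlinarith
      exact ⟨(min_le_right _ _).trans (hlt.trans_le hT).le, fun _ => hlt.trans_le hT⟩

/-- From `(1 − x)(C − xt) ≤ T − xt` (`0 < x < 1`): `T ≥ min(C, xt)`, strictly above `xt` when `C > xt`. [this work] -/
theorem tm_of_slack (x C t T : ℝ) (hx0 : 0 < x) (hx1 : x < 1) (h : (1 - x) * (C - x * t) ≤ T - x * t) :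
    min C (x * t) ≤ T ∧ (x * t < C → x * t < T) := by
  have h1x : 0 < 1 - x := by linarith
  constructor
  · rcases le_or_gt C (x * t) with hle | hlt
    · rw [min_eq_left hle]
      have : 0 ≤ x * (x * t - C) := mul_nonneg hx0.le (by linarith)
      nlinarith
    · rw [min_eq_right hlt.le]
      have : 0 < (1 - x) * (C - x * t) := mul_pos h1x (by linarith)
      linarith
  · intro hlt
    have : 0 < (1 - x) * (C - x * t) := mul_pos h1x (by linarith)
    linarith

/-- **Two lights, the largest conditioned** (`|L'| = 1`): `T = g(t − (t − b)(1 − g₁)) + (1 − g)g₁b₁` for `t ≤ b₁ + b` satisfies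
`T − xt = (1 − x)(C − xt) + (b₁ + b − t)(x² − g₁g)`, `C = K₁ + K`; hence `T ≥ min(C, xt)`, strictly above `xt` when `C > xt`. [this work] -/
theorem tm_two (x g₁ g b₁ b K₁ K t : ℝ) (hx0 : 0 < x) (hx1 : x < 1) (hg₁x : g₁ ≤ x) (hg0 : 0 ≤ g) (hgx : g ≤ x)
    (hK₁ : K₁ * (1 - x) = b₁ * (g₁ - x ^ 2)) (hK : K * (1 - x) = b * (g - x ^ 2)) (ht : t ≤ b₁ + b) :
    min (K₁ + K) (x * t) ≤ g * (t - (t - b) * (1 - g₁)) + (1 - g) * (g₁ * b₁) ∧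
      (x * t < K₁ + K → x * t < g * (t - (t - b) * (1 - g₁)) + (1 - g) * (g₁ * b₁)) := by
  have h1x : 0 < 1 - x := by linarith
  refine tm_of_slack x (K₁ + K) t _ hx0 hx1 ?_
  -- the identity, multiplied by `1 − x`
  have hid : (g * (t - (t - b) * (1 - g₁)) + (1 - g) * (g₁ * b₁) - x * t) * (1 - x) =
      (1 - x) * ((K₁ + K) - x * t) * (1 - x) + (b₁ + b - t) * (x ^ 2 - g₁ * g) * (1 - x) := by
    linear_combination (-(1 - x)) * hK₁ + (-(1 - x)) * hK
  have hgg : g₁ * g ≤ x ^ 2 := by nlinarith [mul_le_mul_of_nonneg_left hg₁x hg0, mul_le_mul_of_nonneg_left hgx hx0.le]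
  have hD : 0 ≤ (b₁ + b - t) * (x ^ 2 - g₁ * g) := mul_nonneg (by linarith) (by linarith)
  have key : (1 - x) * ((K₁ + K) - x * t) * (1 - x) ≤
      (g * (t - (t - b) * (1 - g₁)) + (1 - g) * (g₁ * b₁) - x * t) * (1 - x) := by
    rw [hid]; nlinarith [mul_nonneg hD h1x.le]
  exact le_of_mul_le_mul_right key h1x

/-- **Three lights, the largest conditioned, the other two unreliable** (`|L'| = 2`, `(1 − g₁)(1 − g₂) ≥ 1 − x`):
`T = g(t − (t − b) q₁q₂) + (1 − g)(g₁q₂b₁ + q₁g₂b₂ + g₁g₂·min(b₁ + b₂, t))` with `0 ≤ b₁ ≤ b₂ ≤ t ≤ b₂ + b` satisfies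
`T − xt = (1 − x)(C − xt) + D`, `D = θ(x² − g(1 − q₁q₂)) + g(g₁q₂b₂ + g₂q₁b₁) − g₁g₂(1 − g)(b₁ + b₂ − t)₊ ≥ min(θ, b₁)·(…) ≥ 0`
(`θ = b₁ + b₂ + b − t`; in the second case `D ≥ b₁(x² − g₁g₂)`); hence `T ≥ min(C, xt)`, strictly above `xt` when `C > xt`. [this work] -/
theorem tm_three (x g₁ g₂ g b₁ b₂ b K₁ K₂ K t : ℝ) (hx0 : 0 < x) (hx1 : x < 1)
    (hg₁0 : 0 ≤ g₁) (hg₁x : g₁ ≤ x) (hg₂0 : 0 ≤ g₂) (hg₂x : g₂ ≤ x) (hg0 : 0 ≤ g) (hgx : g ≤ x)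
    (hK₁ : K₁ * (1 - x) = b₁ * (g₁ - x ^ 2)) (hK₂ : K₂ * (1 - x) = b₂ * (g₂ - x ^ 2)) (hK : K * (1 - x) = b * (g - x ^ 2))
    (hb₁ : 0 ≤ b₁) (hb₁₂ : b₁ ≤ b₂) (hb₂t : b₂ ≤ t) (ht : t ≤ b₂ + b) (hQ : 1 - x ≤ (1 - g₁) * (1 - g₂)) :
    min (K₁ + K₂ + K) (x * t) ≤
        g * (t - (t - b) * ((1 - g₁) * (1 - g₂))) + (1 - g) * (g₁ * (1 - g₂) * b₁ + (1 - g₁) * g₂ * b₂ + g₁ * g₂ * min (b₁ + b₂) t) ∧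
      (x * t < K₁ + K₂ + K → x * t <
        g * (t - (t - b) * ((1 - g₁) * (1 - g₂))) + (1 - g) * (g₁ * (1 - g₂) * b₁ + (1 - g₁) * g₂ * b₂ + g₁ * g₂ * min (b₁ + b₂) t)) := by
  have h1x : 0 < 1 - x := by linarith
  have hg1 : 0 ≤ 1 - g := by linarith
  refine tm_of_slack x (K₁ + K₂ + K) t _ hx0 hx1 ?_
  -- the two gate facts
  have hA : g * (1 - (1 - g₁) * (1 - g₂)) ≤ x ^ 2 := by
    have h1 : 1 - (1 - g₁) * (1 - g₂) ≤ x := by linarith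
    have h2 : 0 ≤ 1 - (1 - g₁) * (1 - g₂) := by nlinarith [mul_nonneg hg₁0 hg₂0]
    nlinarith [mul_le_mul hgx h1 h2 hx0.le]
  have hB : g₁ * g₂ ≤ x ^ 2 := by nlinarith [mul_le_mul hg₁x hg₂x hg₂0 hx0.le]
  have hθb₁ : b₁ ≤ b₁ + b₂ + b - t := by linarith
  -- the slack `D` and its sign, in the two cases of `min(b₁ + b₂, t)`
  rcases le_or_gt (b₁ + b₂) t with hm | hm
  · rw [min_eq_left hm]
    have hid : (g * (t - (t - b) * ((1 - g₁) * (1 - g₂))) +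
          (1 - g) * (g₁ * (1 - g₂) * b₁ + (1 - g₁) * g₂ * b₂ + g₁ * g₂ * (b₁ + b₂)) - x * t) * (1 - x) =
        (1 - x) * ((K₁ + K₂ + K) - x * t) * (1 - x) +
          ((b₁ + b₂ + b - t) * (x ^ 2 - g * (1 - (1 - g₁) * (1 - g₂))) + g * (g₁ * (1 - g₂) * b₂ + g₂ * (1 - g₁) * b₁)) * (1 - x) := by
      linear_combination (-(1 - x)) * hK₁ + (-(1 - x)) * hK₂ + (-(1 - x)) * hK
    have hD : 0 ≤ (b₁ + b₂ + b - t) * (x ^ 2 - g * (1 - (1 - g₁) * (1 - g₂))) + g * (g₁ * (1 - g₂) * b₂ + g₂ * (1 - g₁) * b₁) := by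
      have h1 : 0 ≤ (b₁ + b₂ + b - t) * (x ^ 2 - g * (1 - (1 - g₁) * (1 - g₂))) := mul_nonneg (hb₁.trans hθb₁) (by linarith)
      have h2 : 0 ≤ g * (g₁ * (1 - g₂) * b₂ + g₂ * (1 - g₁) * b₁) := by
        refine mul_nonneg hg0 (add_nonneg ?_ ?_)
        · exact mul_nonneg (mul_nonneg hg₁0 (by linarith)) (hb₁.trans hb₁₂)
        · exact mul_nonneg (mul_nonneg hg₂0 (by linarith)) hb₁
      linarith
    have key : (1 - x) * ((K₁ + K₂ + K) - x * t) * (1 - x) ≤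
        (g * (t - (t - b) * ((1 - g₁) * (1 - g₂))) +
          (1 - g) * (g₁ * (1 - g₂) * b₁ + (1 - g₁) * g₂ * b₂ + g₁ * g₂ * (b₁ + b₂)) - x * t) * (1 - x) := by
      rw [hid]; nlinarith [mul_nonneg hD h1x.le]
    exact le_of_mul_le_mul_right key h1x
  · rw [min_eq_right hm.le]
    have hid : (g * (t - (t - b) * ((1 - g₁) * (1 - g₂))) +
          (1 - g) * (g₁ * (1 - g₂) * b₁ + (1 - g₁) * g₂ * b₂ + g₁ * g₂ * t) - x * t) * (1 - x) =
        (1 - x) * ((K₁ + K₂ + K) - x * t) * (1 - x) +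
          ((b₁ + b₂ + b - t) * (x ^ 2 - g * (1 - (1 - g₁) * (1 - g₂))) + g * (g₁ * (1 - g₂) * b₂ + g₂ * (1 - g₁) * b₁)
            - g₁ * g₂ * (1 - g) * (b₁ + b₂ - t)) * (1 - x) := by
      linear_combination (-(1 - x)) * hK₁ + (-(1 - x)) * hK₂ + (-(1 - x)) * hK
    -- `D ≥ b₁ (x² − g₁ g₂) ≥ 0`
    have hD : 0 ≤ (b₁ + b₂ + b - t) * (x ^ 2 - g * (1 - (1 - g₁) * (1 - g₂))) + g * (g₁ * (1 - g₂) * b₂ + g₂ * (1 - g₁) * b₁)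
          - g₁ * g₂ * (1 - g) * (b₁ + b₂ - t) := by
      have hpos : 0 ≤ x ^ 2 - g * (1 - (1 - g₁) * (1 - g₂)) := by linarith
      have h1 : b₁ * (x ^ 2 - g * (1 - (1 - g₁) * (1 - g₂))) ≤ (b₁ + b₂ + b - t) * (x ^ 2 - g * (1 - (1 - g₁) * (1 - g₂))) :=
        mul_le_mul_of_nonneg_right hθb₁ hpos
      have h2 : g * (g₁ * (1 - g₂) * b₁) ≤ g * (g₁ * (1 - g₂) * b₂) :=
        mul_le_mul_of_nonneg_left (mul_le_mul_of_nonneg_left hb₁₂ (mul_nonneg hg₁0 (by linarith))) hg0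
      have h3 : g₁ * g₂ * (1 - g) * (b₁ + b₂ - t) ≤ g₁ * g₂ * (1 - g) * b₁ :=
        mul_le_mul_of_nonneg_left (by linarith) (mul_nonneg (mul_nonneg hg₁0 hg₂0) hg1)
      have e : b₁ * (x ^ 2 - g * (1 - (1 - g₁) * (1 - g₂))) + g * (g₁ * (1 - g₂) * b₁) + g * (g₂ * (1 - g₁) * b₁)
          - g₁ * g₂ * (1 - g) * b₁ = b₁ * (x ^ 2 - g₁ * g₂) := by ring
      have h4 : 0 ≤ b₁ * (x ^ 2 - g₁ * g₂) := mul_nonneg hb₁ (by linarith)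
      have h5 : 0 ≤ g * (g₂ * (1 - g₁) * b₁) := mul_nonneg hg0 (mul_nonneg (mul_nonneg hg₂0 (by linarith)) hb₁)
      linarith
    have key : (1 - x) * ((K₁ + K₂ + K) - x * t) * (1 - x) ≤
        (g * (t - (t - b) * ((1 - g₁) * (1 - g₂))) +
          (1 - g) * (g₁ * (1 - g₂) * b₁ + (1 - g₁) * g₂ * b₂ + g₁ * g₂ * t) - x * t) * (1 - x) := by
      rw [hid]; nlinarith [mul_nonneg hD h1x.le]
    exact le_of_mul_le_mul_right key h1x

/-- `(1 − x²)³ ≤ 1 − x` for `1/2 ≤ x ≤ 1` (`1 − (1 − x)²(1 + x)³ = x·[(2x − 1) + x²(1 − x)(2 + x)]`). [this work] -/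
theorem one_sub_sq_pow_three_le (x : ℝ) (hx : 1 / 2 ≤ x) (hx1 : x ≤ 1) : (1 - x ^ 2) ^ 3 ≤ 1 - x := by
  have h1 : 0 ≤ 1 - x := by linarith
  have e : 1 - x - (1 - x ^ 2) ^ 3 = (1 - x) * (x * ((2 * x - 1) + x ^ 2 * (1 - x) * (2 + x))) := by ring
  have h2 : 0 ≤ x * ((2 * x - 1) + x ^ 2 * (1 - x) * (2 + x)) := by
    refine mul_nonneg (by linarith) (add_nonneg (by linarith) ?_)
    exact mul_nonneg (mul_nonneg (sq_nonneg x) h1) (by linarith)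
  nlinarith [mul_nonneg h1 h2]

end IndepBlob

end Quant

end Summit.CriticalPhenomena.PercolationContinuityZ3.Theorems
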